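import Literature.MathematicalPhysics.QuantumFieldTheory.Balaban1983to89.B13JointWalkExpansion

/-!
# `Balaban1983to89.B13TermWalkData` — T. Bałaban, *Renormalization group approach to lattice gauge field theories. II.
Cluster expansions*, Commun. Math. Phys. **116** (1988) 1–22 [Balaban1988RG2Cluster], p. 13 ∕ p. 15 with [B9] = CMP **99**
(1985) Thm 3.10 p. 416: ONE (2.14)-TERM'S THREE WALK OBJECTS WITH ONE CONSTANT PACKAGE (`TermKernels`, `WalkConsts`,
`TermWalkData` — witnesses `∃`-packaged, ONLY the constants exposed), the two capstones BY NAME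
(`localisation17a_of_termWalkData` = L17a at the walk rate; `differences216_of_termWalkData` = L16a with NO estimate and
NO analyticity assumed, = `B13ExpansionAnalytic.differences216_of_walks` fed from the record), and THE BOOKKEEPING
STATEMENT (v) OF THE CELL'S ROW (D4) AT NODE O, TYPED: `ExistsWalkDataUniform 𝒦 α Rσ₀ := ∃ w, w.Admissible α Rσ₀ ∧ ∀ i,
TermWalkData (𝒦 i) w` (∃w ∀i) versus the per-term `ExistsWalkDataPointwise` (∀i ∃wᵢ) that the tree's theorems consume,
with `existsUniform_of_envelope` (what uniformity costs) and `existsUniform_of_pointwise_finite` (on a finite index the two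
quantifier orders agree — (v) has content only through the infinite index of scales, tori, domains)

statement-level skeleton of published theorems with citation tags; proofs where landed; nothing here is a claim about
the Yang–Mills mass gap

PROVENANCE.  §2–§3 of g1-plan-1's lean-checked skeleton #6 `HOME/g1/skeletons/D4NodeOWalkTarget.lean` v1.1 sha16
eb080c5cc7c2f19a (cell `pub-balaban-gaps`, gen 9, 2026-08-23), FILED by prover seat g1-p2 gen 3 on the planner's
first-refusal offer [G1-PLAN1-G9-SKELETON-6]; declarations byte-identical to the skeleton except the namespace
(`Summit.…Gaps.D4NodeOWalkTarget` → this Literature namespace), the file split (§1 ∕ §4 = `B13JointWalkExpansion`) and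
provenance tags (`[folklore]` on public declarations replaced by the printed locus they serve).  Printed loci quoted
verbatim (render-checked) in `B13SigmaThroughWalks` ∕ `B13JointWalkExpansion`: [II] p. 13 (expansions *"discussed in [13]
for all operators determining Δ_k, and for C^{(k)}(Z₀)"*), p. 15 (analyticity with *"constants α′₀, α′₁ much bigger than
α₀, α₁"*), [B9] Thm 3.10 p. 416 ((3.107)–(3.108), constants depending on `d`, the group, `L`, `M` and the regularity
constants only).  [9] Sect. A = CMP **99** companion *Regular spaces*, «constants uniform in k» — asserted there, the
cell's NODE O.2 (v).

WHAT THIS FILE TYPES.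
§2 `WalkConsts` ∕ `.Admissible`, `TermKernels` (Type-valued record of ONE (2.14)-term's kernel data: `Λ`, `C₀`, `A(σ,u)`,
   `G(σ,u)`, `Γ₀`, `C ≻ 0`, bond locations, `X`, fibre bound, reference identities), `TermWalkData 𝒦 w` (the three objects
   of §1 of `B13JointWalkExpansion` with ONE package `w` + `hfar : d₁(loc b, X) ≥ R_σ`), `localisation17a_of_termWalkData`,
   `differences216_of_termWalkData` (and `…'` through the older door `differences216_of_walks_two`), `TermWalkData.mono`.
§3 `ExistsWalkDataPointwise` ∕ `ExistsWalkDataUniform` ∕ `pointwise_of_uniform` ∕ `existsUniform_of_envelope` ∕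
   `existsUniform_of_pointwise_finite` ∕ `localisation17a_uniform` (one package ⟹ term-INDEPENDENT `K` for NODE A's (2.38)
   sum) ∕ `TorusTerms` + `ExistsUniformAcross` + `uniform_of_across` (the bundled index across tori ∕ scales).
THE FIRST MISSING LEMMA OF ROW (D4) AT NODE O, TYPED (census wording, words of the row UNCHANGED): `ExistsUniformAcross 𝓣 α Rσ₀`
for Bałaban's family `𝓣` of term kernel data across scales `k`, histories, tori of the exhausting sequence and domains
`Z` — [13] Thm 3.15∕3.10-type expansions IN A COMPLEX BACKGROUND with decoupling parameters (cell GAPS G-B9-10), with ONE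
package ([9] Sect. A, (v)); plus `TermDomination`.  IDEA-bound [MEDIUM] at the object, WORK-bound XL at NODE O.
HONEST FRAMING: interface typing + bookkeeping over EXISTING tree declarations; NOTHING of Bałaban's is asserted beyond
print; `def … : Prop` ∕ `structure … : Prop` here are STATEMENTS (hypothesis shapes, D-0026), never claims; NO `sorry`, no
new named fact.  (D4) is NOT discharged (instance 0∕1); NOT B12 Thm 2, NOT `BetaPertH`, NOT continuum ∕ ℝ⁴, NOT infinite
volume, NOT mass gap, NOT Clay.  HONEST DEPENDENCY: continuum YM on T⁴ ⇐ BetaPertH ∧ nine spine estimates (0∕9 proved);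
BetaPertH ⇐ (D1) ∧ (D4) ∧ CAP+tail.
-/

noncomputable section

namespace Literature.MathematicalPhysics.QuantumFieldTheory.Balaban1983to89.B13TermWalkData

open Metric Set Matrix Finset
open Literature.MathematicalPhysics.QuantumFieldTheory.Balaban1983to89
open Literature.MathematicalPhysics.QuantumFieldTheory.Balaban1983to89.B9SectDWalk (Through MajSumLe)
open Literature.MathematicalPhysics.QuantumFieldTheory.Balaban1983to89.B9Thm34Ext (toB6)
open Literature.MathematicalPhysics.QuantumFieldTheory.Balaban1983to89.B9Thm37GlueTorus (torusGeom tdist1 tdist1_nonneg)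
open Literature.MathematicalPhysics.QuantumFieldTheory.Balaban1983to89.TreeLengthTorus (TPt)
open Literature.MathematicalPhysics.QuantumFieldTheory.Balaban1983to89.B5TorusCover (UT)
open Literature.MathematicalPhysics.QuantumFieldTheory.Balaban1983to89.B13PrimitiveKernels216
  (Localisation17a Differences216 localisation17a_of_majorants)
open Literature.MathematicalPhysics.QuantumFieldTheory.Balaban1983to89.B13SigmaThroughWalks
  (SigmaThroughWalks sub_ref_entry_le_torus majorant_torus_of_hasSum differences216_of_walks_two)
open Literature.MathematicalPhysics.QuantumFieldTheory.Balaban1983to89.B13ExpansionAnalytic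
  (differentiableOn_torus_of_hasSum differences216_of_walks)

open Literature.MathematicalPhysics.QuantumFieldTheory.Balaban1983to89.B13JointWalkExpansion
  (JointWalkExpansion WalkMajorants)

/-! ## §2. One (2.14)-term: the three objects with ONE constant package, and the two capstones BY NAME -/

section Term

variable {d N' : ℕ} {ν : ℕ} {Nf : Fin ν → ℕ} [∀ i, NeZero (Nf i)]
variable {E : Type*} [NormedAddCommGroup E] [NormedSpace ℂ E]

/-- **THE CONSTANT PACKAGE** of the walk expansions of a term: analyticity radius `R` (print: the bigger space, `α′₀,
α′₁`), rate drop `ε` (print: `εR_σ = ⅓δ₀M`), torus rate `κ` (print: `δ₀`, then halved repeatedly), the three majorant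
constants `K̄_Γ, K̄_E, K̄_C` (print: `O(1)` = `B₀` of (1.7)∕(1.11), [B9] (3.108)), and the σ-distance `R_σ` (print p. 13:
`dist(X, Z₀) > ⅔M`). [cite: Balaban1988RG2Cluster, (1.11) p.5, p.13, p.15] -/
structure WalkConsts where
  R : ℝ
  ε : ℝ
  kap : ℝ
  KbarΓ : ℝ
  KbarE : ℝ
  KbarC : ℝ
  Rσ : ℝ

/-- Admissibility of a constant package for configurations of size `≤ α` (print: `α₀, α₁` of I.(i)–(iii) versus the
bigger `α′₀, α′₁`) and σ-distance at least `Rσ₀` (print: `⅔M`): `α < R`, `0 ≤ ε`, `0 < κ`, non-negative constants,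
`Rσ₀ ≤ R_σ`.  (USE, not typing, wants more: `2K̄e^{−εR_σ} + 2K̄α/R` small — NODE A's numerics N1–N3.)
[cite: Balaban1988RG2Cluster, p.15, p.16] -/
structure WalkConsts.Admissible (w : WalkConsts) (α Rσ₀ : ℝ) : Prop where
  hαR : α < w.R
  hε : 0 ≤ w.ε
  hkap : 0 < w.kap
  hKbarΓ : 0 ≤ w.KbarΓ
  hKbarE : 0 ≤ w.KbarE
  hKbarC : 0 ≤ w.KbarC
  hRσ : Rσ₀ ≤ w.Rσ

/-- **THE KERNEL DATA OF ONE (2.14)-TERM** `t = (𝐃, P)` of `H(Z)` with small-field region `Z₀` (Type-valued record; the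
DATA binders of `differences216_of_walks_two` ∕ `h226_torus_of_two`): the row bonds `Λ` (bonds of `Z₀`, finitely many,
`≤ m` per site — `hfib`), the extra columns `C₀`, the joint precision `A(σ,u) = Δ^{(k)}(Z₀,σ,𝐔,𝐉)` and Γ-kernel `G(σ,u)`,
the real reference values `Γ₀ = G(0,0)`, `C = A(0,0)⁻¹ ≻ 0` (print p. 15: *"for (U, 0) the operators are symmetric, and
the measure is positive"*), the bond locations on the site torus, and the σ-region `X` (the cubes of `σ₀` outside `Z̃₀`).
Nothing asserted. [cite: Balaban1988RG2Cluster, (2.14)–(2.16) pp.15–16, p.13] -/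
structure TermKernels (c : B13.Consts) (d N' ν : ℕ) (Nf : Fin ν → ℕ) [∀ i, NeZero (Nf i)]
    (E : Type*) [NormedAddCommGroup E] [NormedSpace ℂ E] where
  Λ : Type
  [instFintype : Fintype Λ]
  [instDecEq : DecidableEq Λ]
  C₀ : Type
  A2 : (TPt d N' → ℂ) → E → Matrix Λ Λ ℂ
  G2 : (TPt d N' → ℂ) → E → Matrix Λ (Λ ⊕ C₀) ℂ
  Γ₀ : Matrix Λ (Λ ⊕ C₀) ℝ
  C : Matrix Λ Λ ℝ
  locΛ : Λ → UT Nf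
  locN : Λ ⊕ C₀ → UT Nf
  X : Finset (UT Nf)
  m : ℕ
  hfib : ∀ x : UT Nf, (Finset.univ.filter fun i => locΛ i = x).card ≤ m
  hG0 : G2 0 0 = Γ₀.map (algebraMap ℝ ℂ)
  hC0 : (A2 0 0)⁻¹ = C.map (algebraMap ℝ ℂ)
  hC : C.PosDef

attribute [instance] TermKernels.instFintype TermKernels.instDecEq

variable {c : B13.Consts}

/-- **THE THREE WALK OBJECTS OF ONE TERM WITH ONE CONSTANT PACKAGE `w`** (named hypothesis shape): joint walk expansions
(§1) of the Γ-kernel (constant `K̄_Γ`) and of the precision (`K̄_E`) with σ-structure through the term's `X`, walk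
majorants of the covariance (`K̄_C`), all on the `w.R`-ball with drop `w.ε` and torus rate `w.κ`, and the geometric clause
`d₁(loc b, X) ≥ w.R_σ` for every row bond.  The per-family witnesses (term types `W•`, terms `T•`, sub-families, amplitudes,
walk distances, walk rates) are existentially quantified: only the CONSTANTS are exposed — that is the point of §3.
[cite: Balaban1988RG2Cluster, p.13, p.15, (2.16) p.16; Balaban1985BackgroundPropagators, Thm 3.10 p.416] -/
structure TermWalkData (𝒦 : TermKernels c d N' ν Nf E) (w : WalkConsts) : Prop where
  hΓ : ∃ (W : Type) (T : W → (TPt d N' → ℂ) → E → Matrix 𝒦.Λ (𝒦.Λ ⊕ 𝒦.C₀) ℂ) (SX : Set W) (A : W → ℝ)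
      (D : W → UT Nf → UT Nf → ℝ) (ρ : ℝ), JointWalkExpansion c 𝒦.locΛ 𝒦.locN 𝒦.G2 𝒦.X w.R w.ε w.kap w.KbarΓ T SX A D ρ
  hE : ∃ (W : Type) (T : W → (TPt d N' → ℂ) → E → Matrix 𝒦.Λ 𝒦.Λ ℂ) (SX : Set W) (A : W → ℝ)
      (D : W → UT Nf → UT Nf → ℝ) (ρ : ℝ), JointWalkExpansion c 𝒦.locΛ 𝒦.locΛ 𝒦.A2 𝒦.X w.R w.ε w.kap w.KbarE T SX A D ρ
  hCov : ∃ (W : Type) (T : W → (TPt d N' → ℂ) → E → Matrix 𝒦.Λ 𝒦.Λ ℂ) (A : W → ℝ) (D : W → UT Nf → UT Nf → ℝ) (ρ : ℝ),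
      WalkMajorants c 𝒦.locΛ 𝒦.locΛ (fun σ u => (𝒦.A2 σ u)⁻¹) w.R w.kap w.KbarC T A D ρ
  hfar : ∀ b : 𝒦.Λ, ∀ z ∈ 𝒦.X, w.Rσ ≤ tdist1 Nf (𝒦.locΛ b) z

/-- **CAPSTONE 1 — L17a for the term at the WALK RATE, from the objects** (kernel-checked composition of the tree lemmas
`JointWalkExpansion.majorants` = `majorant_torus_of_hasSum` and `localisation17a_of_majorants`): at every configuration
`u` of the `w.R`-ball the section `σ ↦ (A(σ,u), G(σ,u))` satisfies `Localisation17a` at rate `w.κ` with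
`(K_G, K_Γ, K_Cs, K₀) = (K̄_Γ, K̄_Γ, K̄_C, K̄_C)`. [cite: Balaban1988RG2Cluster, p.13, p.15] -/
theorem localisation17a_of_termWalkData {𝒦 : TermKernels c d N' ν Nf E} {w : WalkConsts} {α Rσ₀ : ℝ}
    (hw : w.Admissible α Rσ₀) (hα : 0 ≤ α) (h : TermWalkData 𝒦 w) {u : E} (hu : u ∈ ball (0 : E) w.R) :
    Localisation17a c (fun σ => 𝒦.A2 σ u) (fun σ => 𝒦.G2 σ u) 𝒦.Γ₀ 𝒦.C 𝒦.locΛ 𝒦.locN w.kap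
      w.KbarΓ w.KbarΓ w.KbarC w.KbarC := by
  obtain ⟨WΓ, TΓ, SXΓ, AΓ, DΓ, ρΓ, hΓ⟩ := h.hΓ
  obtain ⟨WC, TC, AC, DC, ρC, hC⟩ := h.hCov
  exact localisation17a_of_majorants c 𝒦.A2 𝒦.G2 𝒦.locΛ 𝒦.locN (hα.trans_lt hw.hαR) 𝒦.hG0 𝒦.hC0
    (hΓ.majorants hw.hε) hC.majorants hu

/-- **CAPSTONE 2 — L16a for the term from the objects, NO estimate and NO analyticity assumed** (= INTENT-14's grand
capstone `B13ExpansionAnalytic.differences216_of_walks`, p347598, whose 26 object binders `hAΓ … hsumC` are read off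
the three `∃`-packaged structures of `TermWalkData` and whose geometric binder `hfar` is the record's field): at every
configuration `‖u‖ ≤ α` (`α < w.R`) at which `A(σ,u)` is symmetric with `Re ≻ 0` on the polydisc, `Differences216` at
any twice-dropped rate `0 ≤ κ″ < κ′ < w.κ` with `θ_Γ = 2K̄_Γe^{−εR_σ} + 2K̄_Γα/R`, `θ_E = 2K̄_Ee^{−εR_σ} + 2K̄_Eα/R` and the
derived `θ_C = K̄_C·θ_E·(m(1+2/(κ−κ′))^ν)·K̄_C·(m(1+2/(κ′−κ″))^ν)` — print's `O(1)e^{−⅓δ₀M} + O(α₀ + α₁)`.  The remaining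
hypotheses `hAs hA` (symmetry ∕ `Re ≻ 0` of the precision at `(σ,u)`) are NODE A inputs ([II] p. 15), not walk data.
[cite: Balaban1988RG2Cluster, (2.16) p.16, p.15, p.13, (1.11) p.5; Balaban1985BackgroundPropagators, Thm 3.10 p.416] -/
theorem differences216_of_termWalkData {𝒦 : TermKernels c d N' ν Nf E} {w : WalkConsts} {α Rσ₀ : ℝ}
    (hw : w.Admissible α Rσ₀) (hα : 0 ≤ α) (h : TermWalkData 𝒦 w)
    {kap' kap'' : ℝ} (hkap'' : 0 ≤ kap'') (h1 : kap'' < kap') (h2 : kap' < w.kap)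
    {u : E} (hu : ‖u‖ ≤ α)
    (hAs : ∀ σ : TPt d N' → ℂ, (∀ j, ‖σ j‖ ≤ Real.exp c.κ₁) → (𝒦.A2 σ u).IsSymm)
    (hA : ∀ σ : TPt d N' → ℂ, (∀ j, ‖σ j‖ ≤ Real.exp c.κ₁) → ((𝒦.A2 σ u).map Complex.re).PosDef) :
    Differences216 c (fun σ => 𝒦.A2 σ u) (fun σ => 𝒦.G2 σ u) 𝒦.Γ₀ 𝒦.C 𝒦.locΛ 𝒦.locN kap''
      (2 * w.KbarΓ * Real.exp (-(w.ε * w.Rσ)) + 2 * w.KbarΓ * α / w.R)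
      (w.KbarC * (2 * w.KbarE * Real.exp (-(w.ε * w.Rσ)) + 2 * w.KbarE * α / w.R)
        * (𝒦.m * (1 + 2 / (w.kap - kap')) ^ ν) * w.KbarC * (𝒦.m * (1 + 2 / (kap' - kap'')) ^ ν))
      (2 * w.KbarE * Real.exp (-(w.ε * w.Rσ)) + 2 * w.KbarE * α / w.R) := by
  obtain ⟨WΓ, TΓ, SXΓ, AΓ, DΓ, ρΓ, hΓ⟩ := h.hΓ
  obtain ⟨WE, TE, SXE, AE, DE, ρE, hE⟩ := h.hE
  obtain ⟨WC, TC, AC, DC, ρC, hC⟩ := h.hCov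
  exact differences216_of_walks c 𝒦.A2 𝒦.G2 𝒦.hC 𝒦.locΛ 𝒦.locN 𝒦.hfib (hα.trans_lt hw.hαR) hw.hαR hα hkap'' h1 h2
    𝒦.hG0 𝒦.hC0 hu hAs hA hw.hε hw.hKbarΓ hw.hKbarE hw.hKbarC hΓ.A_nonneg hE.A_nonneg hC.A_nonneg hΓ.D_nonneg
    hE.D_nonneg hΓ.hasSum hΓ.termAnalytic hΓ.maj hΓ.majSum hΓ.indep hΓ.through hE.hasSum hE.termAnalytic hE.maj
    hE.majSum hE.indep hE.through hC.hasSum hC.maj hC.majSum h.hfar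

/-- **CAPSTONE 2′ — the same through the tree's older door** (`B13SigmaThroughWalks.differences216_of_walks_two`, p346614 ✓,
fed by the §1 projections `sigmaThroughWalks ∕ majSum ∕ majorants ∕ analyticOnBall`): identical statement; recorded to
show that the record's fields are EXACTLY the (T3a) object binders + (T3b) binders of NODE A.4. [cite: Balaban1988RG2Cluster, (2.16) p.16, p.15] -/
theorem differences216_of_termWalkData' {𝒦 : TermKernels c d N' ν Nf E} {w : WalkConsts} {α Rσ₀ : ℝ}
    (hw : w.Admissible α Rσ₀) (hα : 0 ≤ α) (h : TermWalkData 𝒦 w)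
    {kap' kap'' : ℝ} (hkap'' : 0 ≤ kap'') (h1 : kap'' < kap') (h2 : kap' < w.kap)
    {u : E} (hu : ‖u‖ ≤ α)
    (hAs : ∀ σ : TPt d N' → ℂ, (∀ j, ‖σ j‖ ≤ Real.exp c.κ₁) → (𝒦.A2 σ u).IsSymm)
    (hA : ∀ σ : TPt d N' → ℂ, (∀ j, ‖σ j‖ ≤ Real.exp c.κ₁) → ((𝒦.A2 σ u).map Complex.re).PosDef) :
    Differences216 c (fun σ => 𝒦.A2 σ u) (fun σ => 𝒦.G2 σ u) 𝒦.Γ₀ 𝒦.C 𝒦.locΛ 𝒦.locN kap''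
      (2 * w.KbarΓ * Real.exp (-(w.ε * w.Rσ)) + 2 * w.KbarΓ * α / w.R)
      (w.KbarC * (2 * w.KbarE * Real.exp (-(w.ε * w.Rσ)) + 2 * w.KbarE * α / w.R)
        * (𝒦.m * (1 + 2 / (w.kap - kap')) ^ ν) * w.KbarC * (𝒦.m * (1 + 2 / (kap' - kap'')) ^ ν))
      (2 * w.KbarE * Real.exp (-(w.ε * w.Rσ)) + 2 * w.KbarE * α / w.R) := by
  obtain ⟨WΓ, TΓ, SXΓ, AΓ, DΓ, ρΓ, hΓ⟩ := h.hΓ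
  obtain ⟨WE, TE, SXE, AE, DE, ρE, hE⟩ := h.hE
  obtain ⟨WC, TC, AC, DC, ρC, hC⟩ := h.hCov
  have hR : 0 < w.R := hα.trans_lt hw.hαR
  exact differences216_of_walks_two c 𝒦.A2 𝒦.G2 𝒦.hC 𝒦.locΛ 𝒦.locN 𝒦.hfib hR hw.hαR hα hkap'' h1 h2
    hw.hKbarΓ hw.hKbarC hw.hKbarE 𝒦.hG0 𝒦.hC0 hu hAs hA hw.hε hw.hKbarΓ hw.hKbarE
    (hΓ.sigmaThroughWalks hR) hΓ.majSum (hE.sigmaThroughWalks hR) hE.majSum h.hfar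
    (hΓ.analyticOnBall hw.hε) (hΓ.majorants hw.hε) (hE.analyticOnBall hw.hε) (hE.majorants hw.hε) hC.majorants

/-- **Monotonicity of `TermWalkData` in the package** (the envelope step): smaller ball, smaller drop, smaller torus
rate, larger constants, smaller σ-distance ([B9] Thm 3.10: the constants of (3.108) may be weakened freely).
[cite: Balaban1985BackgroundPropagators, Thm 3.10 p.416] -/
theorem TermWalkData.mono {𝒦 : TermKernels c d N' ν Nf E} {w w' : WalkConsts} (h : TermWalkData 𝒦 w)
    (hR : w'.R ≤ w.R) (hε : w'.ε ≤ w.ε) (hkap : w'.kap ≤ w.kap)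
    (h0Γ : 0 ≤ w.KbarΓ) (h0E : 0 ≤ w.KbarE) (h0C : 0 ≤ w.KbarC)
    (hΓ : w.KbarΓ ≤ w'.KbarΓ) (hE : w.KbarE ≤ w'.KbarE) (hC : w.KbarC ≤ w'.KbarC) (hRσ : w'.Rσ ≤ w.Rσ) :
    TermWalkData 𝒦 w' := by
  obtain ⟨WΓ, TΓ, SXΓ, AΓ, DΓ, ρΓ, hΓ'⟩ := h.hΓ
  obtain ⟨WE, TE, SXE, AE, DE, ρE, hE'⟩ := h.hE
  obtain ⟨WC, TC, AC, DC, ρC, hC'⟩ := h.hCov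
  exact ⟨⟨WΓ, TΓ, SXΓ, AΓ, DΓ, ρΓ, hΓ'.mono hR hε hkap h0Γ hΓ⟩, ⟨WE, TE, SXE, AE, DE, ρE, hE'.mono hR hε hkap h0E hE⟩,
    ⟨WC, TC, AC, DC, ρC, hC'.mono hR hkap h0C hC⟩, fun b z hz => hRσ.trans (h.hfar b z hz)⟩

end Term

/-! ## §3. THE BOOKKEEPING STATEMENT (v): one constant package for the whole family of terms — ∃w ∀i, not ∀i ∃wᵢ -/

section Uniform

variable {d N' : ℕ} {ν : ℕ} {Nf : Fin ν → ℕ} [∀ i, NeZero (Nf i)]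
variable {E : Type*} [NormedAddCommGroup E] [NormedSpace ℂ E]
variable {c : B13.Consts} {ι : Type*}

/-- **PER-TERM EXISTENCE** (what the tree's theorems consume, one term at a time): every term of the family has walk
objects with SOME admissible package `wᵢ`. [cite: Balaban1988RG2Cluster, p.13, p.15] -/
def ExistsWalkDataPointwise (𝒦 : ι → TermKernels c d N' ν Nf E) (α Rσ₀ : ℝ) : Prop :=
  ∀ i, ∃ w : WalkConsts, w.Admissible α Rσ₀ ∧ TermWalkData (𝒦 i) w

/-- **THE FIRST MISSING LEMMA OF ROW (D4) AT NODE O, TYPED — UNIFORM EXISTENCE (v)**: ONE admissible constant package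
`w` serves EVERY term of the family (index `i` = the (2.14)-term `(Z₀, 𝐃, P)`, the localization domain `Z`, and — in the
bundled form `ExistsUniformAcross` — the torus and the scale).  Print: [II] p. 13 *"generalized random walk expansions
discussed in [13] for all operators determining Δ_k, and for C^{(k)}(Z₀)"*, p. 15 (analyticity with `α′₀, α′₁`), with
[B9] Thm 3.10's constants depending on `d`, the group, `L`, `M` and the regularity constants ONLY; for Bałaban's operators
this is ASSERTED in print for the complex backgrounds and decoupling parameters of §2 and typed nowhere (cell GAPS
G-B9-10 + NODE O.2 (v)).  This `def` is the STATEMENT, not a claim. [cite: Balaban1988RG2Cluster, p.13, p.15; Balaban1985BackgroundPropagators, Thm 3.10 p.416] -/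
def ExistsWalkDataUniform (𝒦 : ι → TermKernels c d N' ν Nf E) (α Rσ₀ : ℝ) : Prop :=
  ∃ w : WalkConsts, w.Admissible α Rσ₀ ∧ ∀ i, TermWalkData (𝒦 i) w

/-- Uniform ⟹ pointwise (the trivial direction of the quantifier exchange). [cite: Balaban1988RG2Cluster, p.13, p.15] -/
theorem pointwise_of_uniform {𝒦 : ι → TermKernels c d N' ν Nf E} {α Rσ₀ : ℝ}
    (h : ExistsWalkDataUniform 𝒦 α Rσ₀) : ExistsWalkDataPointwise 𝒦 α Rσ₀ :=
  fun i => let ⟨w, hw, hall⟩ := h; ⟨w, hw, hall i⟩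

/-- **WHAT UNIFORMITY COSTS — the envelope lemma.**  Pointwise data with packages `wᵢ` become uniform data as soon as the
constants are ENVELOPED by one admissible package `w`: `w.R ≤ inf R_i` (still `> α`), `w.ε ≤ inf ε_i`, `w.κ ≤ inf κ_i`
(still `> 0`), `w.K̄_• ≥ sup K̄_•,i` (finite!), `w.R_σ ≤ inf R_σ,i` (still `≥ Rσ₀`).  For Bałaban's family the content is
exactly `sup_i K̄_i < ∞ ∧ inf_i κ_i > 0 ∧ inf_i R_i > α` over ALL terms, domains, tori and scales — the k-, Z- and
volume-independence of [B9]'s constants. [cite: Balaban1985BackgroundPropagators, Thm 3.10 p.416; Balaban1988RG2Cluster, p.13] -/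
theorem existsUniform_of_envelope {𝒦 : ι → TermKernels c d N' ν Nf E} {α Rσ₀ : ℝ} (wi : ι → WalkConsts)
    (hwi : ∀ i, (wi i).Admissible α Rσ₀) (hdat : ∀ i, TermWalkData (𝒦 i) (wi i))
    (w : WalkConsts) (hw : w.Admissible α Rσ₀)
    (hR : ∀ i, w.R ≤ (wi i).R) (hε : ∀ i, w.ε ≤ (wi i).ε) (hkap : ∀ i, w.kap ≤ (wi i).kap)
    (hΓ : ∀ i, (wi i).KbarΓ ≤ w.KbarΓ) (hE : ∀ i, (wi i).KbarE ≤ w.KbarE) (hC : ∀ i, (wi i).KbarC ≤ w.KbarC)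
    (hRσ : ∀ i, w.Rσ ≤ (wi i).Rσ) :
    ExistsWalkDataUniform 𝒦 α Rσ₀ :=
  ⟨w, hw, fun i => (hdat i).mono (hR i) (hε i) (hkap i) (hwi i).hKbarΓ (hwi i).hKbarE (hwi i).hKbarC
    (hΓ i) (hE i) (hC i) (hRσ i)⟩

/-- **For a FINITE family the two quantifier orders agree** (so (v) has content only through the INFINITE index: all
scales `k`, all tori of the exhausting sequence, all domains and terms — for one torus at one scale the set of terms is
finite and uniformity is free): pointwise admissible data on a `Fintype` index with at least one term envelope to uniform
data. [cite: Balaban1985BackgroundPropagators, Thm 3.10 p.416; Balaban1988RG2Cluster, p.13] -/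
theorem existsUniform_of_pointwise_finite [Fintype ι] [Nonempty ι] {𝒦 : ι → TermKernels c d N' ν Nf E} {α Rσ₀ : ℝ}
    (h : ExistsWalkDataPointwise 𝒦 α Rσ₀) : ExistsWalkDataUniform 𝒦 α Rσ₀ := by
  classical
  choose wi hwi hdat using (h : ∀ i, ∃ w : WalkConsts, w.Admissible α Rσ₀ ∧ TermWalkData (𝒦 i) w)
  obtain ⟨i₀⟩ := ‹Nonempty ι›
  -- the envelope: min of the radii ∕ drops ∕ rates ∕ σ-distances, max of the constants, over the finite index
  have hne : (Finset.univ : Finset ι).Nonempty := ⟨i₀, Finset.mem_univ _⟩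
  refine existsUniform_of_envelope wi hwi hdat
    ⟨Finset.univ.inf' hne fun i => (wi i).R, Finset.univ.inf' hne fun i => (wi i).ε,
      Finset.univ.inf' hne fun i => (wi i).kap, Finset.univ.sup' hne fun i => (wi i).KbarΓ,
      Finset.univ.sup' hne fun i => (wi i).KbarE, Finset.univ.sup' hne fun i => (wi i).KbarC,
      Finset.univ.inf' hne fun i => (wi i).Rσ⟩
    ?_ (fun i => Finset.inf'_le _ (Finset.mem_univ i)) (fun i => Finset.inf'_le _ (Finset.mem_univ i))
    (fun i => Finset.inf'_le _ (Finset.mem_univ i)) (fun i => Finset.le_sup' (fun i => (wi i).KbarΓ) (Finset.mem_univ i))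
    (fun i => Finset.le_sup' (fun i => (wi i).KbarE) (Finset.mem_univ i))
    (fun i => Finset.le_sup' (fun i => (wi i).KbarC) (Finset.mem_univ i))
    (fun i => Finset.inf'_le _ (Finset.mem_univ i))
  -- admissibility of the envelope: each clause is attained at some index
  refine ⟨?_, ?_, ?_, ?_, ?_, ?_, ?_⟩
  · show α < Finset.univ.inf' hne fun i => (wi i).R
    obtain ⟨i, -, hi⟩ := Finset.exists_mem_eq_inf' hne fun i => (wi i).R
    rw [hi]; exact (hwi i).hαR
  · show 0 ≤ Finset.univ.inf' hne fun i => (wi i).ε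
    obtain ⟨i, -, hi⟩ := Finset.exists_mem_eq_inf' hne fun i => (wi i).ε
    rw [hi]; exact (hwi i).hε
  · show 0 < Finset.univ.inf' hne fun i => (wi i).kap
    obtain ⟨i, -, hi⟩ := Finset.exists_mem_eq_inf' hne fun i => (wi i).kap
    rw [hi]; exact (hwi i).hkap
  · show 0 ≤ Finset.univ.sup' hne fun i => (wi i).KbarΓ
    exact (hwi i₀).hKbarΓ.trans (Finset.le_sup' (fun i => (wi i).KbarΓ) (Finset.mem_univ i₀))
  · show 0 ≤ Finset.univ.sup' hne fun i => (wi i).KbarE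
    exact (hwi i₀).hKbarE.trans (Finset.le_sup' (fun i => (wi i).KbarE) (Finset.mem_univ i₀))
  · show 0 ≤ Finset.univ.sup' hne fun i => (wi i).KbarC
    exact (hwi i₀).hKbarC.trans (Finset.le_sup' (fun i => (wi i).KbarC) (Finset.mem_univ i₀))
  · show Rσ₀ ≤ Finset.univ.inf' hne fun i => (wi i).Rσ
    obtain ⟨i, -, hi⟩ := Finset.exists_mem_eq_inf' hne fun i => (wi i).Rσ
    rw [hi]; exact (hwi i).hRσ

/-- **The uniform statement feeds the tree's per-term capstone with ONE package** (L17a at the common rate `w.κ` with the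
common constants, for every term and every configuration of the common ball): the form in which NODE A's (2.38)-assembly
`B13Lemma3TorusTerms.hrep_of_termwise` ∕ `bound238_torus_of_226` can sum over terms with term-INDEPENDENT `K, θ`.
[cite: Balaban1988RG2Cluster, p.13, p.15, (2.26) p.17] -/
theorem localisation17a_uniform {𝒦 : ι → TermKernels c d N' ν Nf E} {α Rσ₀ : ℝ} (hα : 0 ≤ α)
    (h : ExistsWalkDataUniform 𝒦 α Rσ₀) :
    ∃ w : WalkConsts, w.Admissible α Rσ₀ ∧ ∀ i, ∀ u ∈ ball (0 : E) w.R,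
      Localisation17a c (fun σ => (𝒦 i).A2 σ u) (fun σ => (𝒦 i).G2 σ u) (𝒦 i).Γ₀ (𝒦 i).C (𝒦 i).locΛ (𝒦 i).locN
        w.kap w.KbarΓ w.KbarΓ w.KbarC w.KbarC := by
  obtain ⟨w, hw, hall⟩ := h
  exact ⟨w, hw, fun i u hu => localisation17a_of_termWalkData hw hα (hall i) hu⟩

/-- **ACROSS TORI AND SCALES** (the bundled index): a member of the exhausting family carries its own torus
(`N'`, `ν`, `Nf`), configuration space `E` and term family; (v) in full = ONE package for all members and all their terms.
[cite: Balaban1988RG2Cluster, p.13; Balaban1985BackgroundPropagators, Thm 3.10 p.416] -/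
structure TorusTerms (c : B13.Consts) (d : ℕ) where
  N' : ℕ
  ν : ℕ
  Nf : Fin ν → ℕ
  [instNf : ∀ i, NeZero (Nf i)]
  E : Type
  [instE₁ : NormedAddCommGroup E]
  [instE₂ : NormedSpace ℂ E]
  ι : Type
  𝒦 : ι → TermKernels c d N' ν Nf E

attribute [instance] TorusTerms.instNf TorusTerms.instE₁ TorusTerms.instE₂

/-- **(v) IN FULL**: one admissible package for every member `𝓣 s` (`s` = (scale `k`, history `p`, torus index `n`,
domain `Z`) of Bałaban's construction) and every term of it.  STATEMENT ONLY. [cite: Balaban1988RG2Cluster, p.13, p.15] -/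
def ExistsUniformAcross {S : Type*} (𝓣 : S → TorusTerms c d) (α Rσ₀ : ℝ) : Prop :=
  ∃ w : WalkConsts, w.Admissible α Rσ₀ ∧ ∀ s, ∀ i : (𝓣 s).ι, TermWalkData ((𝓣 s).𝒦 i) w

/-- Across ⟹ uniform on each member. [cite: Balaban1988RG2Cluster, p.13, p.15] -/
theorem uniform_of_across {S : Type*} {𝓣 : S → TorusTerms c d} {α Rσ₀ : ℝ} (h : ExistsUniformAcross 𝓣 α Rσ₀)
    (s : S) : ExistsWalkDataUniform (𝓣 s).𝒦 α Rσ₀ :=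
  let ⟨w, hw, hall⟩ := h; ⟨w, hw, hall s⟩

end Uniform

end Literature.MathematicalPhysics.QuantumFieldTheory.Balaban1983to89.B13TermWalkData

end
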